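import Literature.AlgebraicGeometry.Resolution.RegularLocalHeights
import Literature.AlgebraicGeometry.Resolution.MacaulayficationDSequences
import Literature.AlgebraicGeometry.Resolution.CohenMacaulayLocalization
import HarnessLib

/-!
# Lifting secant sequences of a module to regular sequences of a regular local ring

Topic: `Literature/AlgebraicGeometry/Resolution` (input of the Ext-annihilator form of the
Schenzel / Bruns–Herzog annihilator theorem, `ParameterColonAnnihilatorRegular.lean`).

Let `S` be a regular local ring of dimension `n`, `M ≠ 0` a finite `S`-module of dimension `d`,
and `r₁, …, r_s ∈ 𝔪` a secant sequence for `M` (part of a system of parameters of `M`).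

* `exists_add_mem_forall_notMem` — **prime avoidance for a coset** (E. Davis; Kaplansky,
  *Commutative Rings*, Thm. 124): if no prime of a finite family contains both `x` and the ideal
  `I`, then `x + a` avoids all of them for some `a ∈ I`.
* `exists_add_mem_le_height_sup_span_singleton` — the height-raising form: some `x + a`, `a ∈ I`,
  raises the height of `J` when `ht(I + J + (x)) > ht J`.
* `isWeaklyRegular_of_length_le_height` — in a regular local ring, elements `x₁, …, x_ℓ ∈ 𝔪`
  generating an ideal of height `ℓ` form a (weakly) regular sequence (they extend to a system of
  parameters, which is regular in a Cohen–Macaulay ring, Matsumura Thm. 17.4 (iii)).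
* `exists_lift_secantSequence` — the `rᵢ` can be modified by elements of `Ann M` to
  `r'ᵢ ∈ rᵢ + Ann M` with `ht(r'₁, …, r'_k) ≥ k` for all `k` (so `r'` is `S`-regular, and the
  colon modules `((r'₁,…,r'ᵢ)M : r'_{i+1})` are those of `r`).
* `exists_isWeaklyRegular_take_append` — for each `k`, there are `y₁, …, y_{n-d} ∈ Ann M` with
  `r'₁, …, r'_k, y₁, …, y_{n-d}` weakly regular on `S`.

[cite: Kaplansky1974, Thm. 124; Matsumura1987, Thm. 17.4 (iii); Cesnavicius2021, §3.2]
-/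

noncomputable section

open IsLocalRing Ideal Module RingTheory.Sequence
open Literature.RingTheory.TightClosure

universe u v

namespace Literature.AlgebraicGeometry.Resolution

/-! ## Prime avoidance for a coset -/

section Avoidance

variable {R : Type u} [CommRing R]

/-- **Prime avoidance for a coset** (Davis; Kaplansky Thm. 124): let `T` be a finite set of prime
ideals, `x ∈ R`, `I` an ideal, such that no `K ∈ T` contains both `x` and `I`. Then `x + a ∉ K` for
all `K ∈ T`, for some `a ∈ I`. Proof: reduce to the maximal members of `T`; take
`a ∈ I · ∏{K maximal, x ∉ K}` outside every maximal `K ∋ x` (prime avoidance).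
[cite: Kaplansky1974, Thm. 124] -/
theorem exists_add_mem_forall_notMem (I : Ideal R) (x : R) {T : Set (Ideal R)} (hT : T.Finite)
    (hprime : ∀ K ∈ T, K.IsPrime) (h : ∀ K ∈ T, x ∈ K → ¬ I ≤ K) :
    ∃ a ∈ I, ∀ K ∈ T, x + a ∉ K := by
  classical
  set Tf : Finset (Ideal R) := hT.toFinset with hTf
  have hmemTf : ∀ K, K ∈ Tf ↔ K ∈ T := fun K => hT.mem_toFinset
  -- the maximal members of `T`, split according to `x ∈ K`
  set Tmax : Finset (Ideal R) := Tf.filter (fun K => Maximal (· ∈ Tf) K) with hTmax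
  set T₁ : Finset (Ideal R) := Tmax.filter (fun K => x ∈ K) with hT₁
  set T₂ : Finset (Ideal R) := Tmax.filter (fun K => x ∉ K) with hT₂
  set P : Ideal R := I * ∏ K ∈ T₂, K with hP
  -- `P ≤ K₁` for no `K₁ ∈ T₁`
  have havoid' : ¬ ∃ K₁ ∈ T₁, P ≤ K₁ := by
    rintro ⟨K₁, hK₁, hle⟩
    have hK₁' := Finset.mem_filter.mp hK₁
    have hK₁max := (Finset.mem_filter.mp hK₁'.1).2
    have hK₁T : K₁ ∈ T := (hmemTf K₁).mp hK₁max.1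
    have hK₁p : K₁.IsPrime := hprime K₁ hK₁T
    rcases hK₁p.mul_le.mp hle with hI | hprod
    · exact h K₁ hK₁T hK₁'.2 hI
    · obtain ⟨K₂, hK₂, hK₂le⟩ := hK₁p.prod_le.mp hprod
      have hK₂' := Finset.mem_filter.mp hK₂
      have hK₂max := (Finset.mem_filter.mp hK₂'.1).2
      -- maximality of `K₂` forces `K₁ ≤ K₂`, hence `x ∈ K₂`
      exact hK₂'.2 (hK₂max.2 hK₁max.1 hK₂le hK₁'.2)
  -- prime avoidance: `P ⊄ ⋃ T₁`
  have havoid : ¬ ((P : Set R) ⊆ ⋃ K ∈ (T₁ : Set (Ideal R)), (K : Set R)) := fun hsub =>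
    havoid' ((Ideal.subset_union_prime (s := T₁) (f := fun K : Ideal R => K) P P
      (fun K hK _ _ => hprime K ((hmemTf K).mp (Finset.mem_filter.mp
        (Finset.mem_filter.mp hK).1).1))).mp hsub)
  obtain ⟨a, haP, ha⟩ := Set.not_subset.mp havoid
  have haI : a ∈ I := Ideal.mul_le_right haP
  have haT₂ : ∀ K ∈ T₂, a ∈ K := fun K hK =>
    (Ideal.mul_le_left.trans (Ideal.prod_le_inf.trans (Finset.inf_le hK))) haP
  have haT₁ : ∀ K ∈ T₁, a ∉ K := fun K hK haK => ha (Set.mem_biUnion hK haK)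
  refine ⟨a, haI, fun K hK hxa => ?_⟩
  -- `K ≤ K'` for a maximal member `K'`
  obtain ⟨K', hKK', hK'max⟩ := Tf.exists_le_maximal ((hmemTf K).mpr hK)
  have hK'Tmax : K' ∈ Tmax := Finset.mem_filter.mpr ⟨hK'max.1, hK'max⟩
  have hxa' : x + a ∈ K' := hKK' hxa
  by_cases hx : x ∈ K'
  · have h1 : K' ∈ T₁ := Finset.mem_filter.mpr ⟨hK'Tmax, hx⟩
    exact haT₁ K' h1 (by simpa using K'.sub_mem hxa' hx)
  · have h2 : K' ∈ T₂ := Finset.mem_filter.mpr ⟨hK'Tmax, hx⟩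
    exact hx (by simpa using K'.sub_mem hxa' (haT₂ K' h2))

/-- Lists that are congruent elementwise modulo `I` generate the same ideal modulo `I`. [folklore] -/
theorem sup_ofList_eq_of_sub_mem (I : Ideal R) {xs ys : List R} (hlen : xs.length = ys.length)
    (h : ∀ (i : ℕ) (hi : i < xs.length) (hi' : i < ys.length), xs[i] - ys[i] ∈ I) :
    I ⊔ ofList xs = I ⊔ ofList ys := by
  have key : ∀ {xs ys : List R}, xs.length = ys.length →
      (∀ (i : ℕ) (hi : i < xs.length) (hi' : i < ys.length), xs[i] - ys[i] ∈ I) →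
        ofList xs ≤ I ⊔ ofList ys := by
    intro xs ys hlen h
    refine Ideal.span_le.mpr fun x hx => ?_
    obtain ⟨i, hi, rfl⟩ := List.mem_iff_getElem.mp hx
    have hi' : i < ys.length := hlen ▸ hi
    have : xs[i] = (xs[i] - ys[i]) + ys[i] := by ring
    rw [this]
    exact Ideal.add_mem _ (Ideal.mem_sup_left (h i hi hi'))
      (Ideal.mem_sup_right (Ideal.subset_span (List.getElem_mem hi')))
  refine le_antisymm (sup_le le_sup_left (key hlen h)) (sup_le le_sup_left (key hlen.symm ?_))
  intro i hi hi'
  simpa using I.neg_mem (h i hi' hi)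

variable [IsNoetherianRing R]

/-- **The height-raising coset step.** In a Noetherian ring, if `r ≤ ht J` and
`r < ht (I + J + (x))`, then `r + 1 ≤ ht (J + (x + a))` for some `a ∈ I`: choose `x + a` outside the
finitely many minimal primes of `J` of height `r` (none contains both `x` and `I`).
[cite: Kaplansky1974, Thm. 124] -/
theorem exists_add_mem_le_height_sup_span_singleton (I J : Ideal R) (x : R) (r : ℕ)
    (hJ : (r : ℕ∞) ≤ J.height) (hI : (r : ℕ∞) < (I ⊔ J ⊔ Ideal.span {x}).height) :
    ∃ a ∈ I, (r : ℕ∞) + 1 ≤ (J ⊔ Ideal.span {x + a}).height := by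
  -- the minimal primes of `J` of height exactly `r`
  set T : Set (Ideal R) := {K | K ∈ J.minimalPrimes ∧ K.height = r} with hT
  have hTfin : T.Finite := J.finite_minimalPrimes_of_isNoetherianRing.subset fun _ h => h.1
  have hcoset : ∀ K ∈ T, x ∈ K → ¬ I ≤ K := by
    intro K hK hxK hIK
    have hle : I ⊔ J ⊔ Ideal.span {x} ≤ K :=
      sup_le (sup_le hIK hK.1.1.2) ((Ideal.span_singleton_le_iff_mem _).mpr hxK)
    have h := hI.trans_le (Ideal.height_mono hle)
    rw [hK.2] at h
    exact lt_irrefl _ h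
  obtain ⟨a, haI, ha⟩ := exists_add_mem_forall_notMem I x hTfin (fun K hK => hK.1.1.1) hcoset
  refine ⟨a, haI, ?_⟩
  rw [(J ⊔ Ideal.span {x + a}).height_eq_inf_minimalPrimes]
  refine le_iInf₂ fun Q hQ => ?_
  have hQp : Q.IsPrime := hQ.1.1
  have hJQ : J ≤ Q := le_sup_left.trans hQ.1.2
  have hyQ : x + a ∈ Q := hQ.1.2 (Ideal.mem_sup_right (Ideal.mem_span_singleton_self _))
  have hrQ : (r : ℕ∞) ≤ Q.height := hJ.trans (Ideal.height_mono hJQ)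
  rcases hrQ.lt_or_eq with hlt | heq
  · exact Order.add_one_le_of_lt hlt
  · exact absurd hyQ (ha Q ⟨Ideal.mem_minimalPrimes_of_height_eq hJQ (heq.ge.trans hJ), heq.symm⟩)

end Avoidance

/-! ## Sequences of the right height are regular -/

section Regular

variable {S : Type u} [CommRing S] [IsRegularLocalRing S]

/-- **In a regular local ring, `ℓ` elements of `𝔪` generating an ideal of height `≥ ℓ` form a weakly
regular sequence**: they extend (prime avoidance) to a system of parameters, and every system of
parameters of a Cohen–Macaulay local ring is a regular sequence in any order (Matsumura
Thm. 17.4 (iii); regular ⇒ Cohen–Macaulay, Thm. 17.8). [cite: Matsumura1987, Thm. 17.4 (iii)] -/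
theorem isWeaklyRegular_of_length_le_height {xs : List S} (hmem : ∀ x ∈ xs, x ∈ maximalIdeal S)
    (hht : (xs.length : ℕ∞) ≤ (ofList xs).height) : IsWeaklyRegular S xs := by
  obtain ⟨n, hn⟩ := exists_nat_cast_eq_ringKrullDim (R := S)
  have hmax : (maximalIdeal S).height = n := by
    have := IsLocalRing.maximalIdeal_height_eq_ringKrullDim (R := S)
    rw [hn] at this
    exact_mod_cast this
  have hle𝔪 : ofList xs ≤ maximalIdeal S := Ideal.span_le.mpr fun x hx => hmem x hx
  -- `ℓ ≤ n`
  have hℓ : xs.length ≤ n := by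
    have := hht.trans (Ideal.height_mono hle𝔪)
    rw [hmax] at this
    exact_mod_cast this
  obtain ⟨e, he⟩ := Nat.exists_eq_add_of_le hℓ
  -- extend to a system of parameters
  obtain ⟨t, htm, ht⟩ := exists_forall_mem_and_le_height (maximalIdeal S) (ofList xs) xs.length hht
    e (by rw [hmax, he])
  set zs : List S := xs ++ List.ofFn t with hzs
  have hzslen : zs.length = n := by
    rw [hzs, List.length_append, List.length_ofFn, he]
  have hzsI : ofList zs = ofList xs ⊔ Ideal.span (Set.range t) := by
    rw [hzs, ofList_append]
    congr 1
    apply congrArg Ideal.span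
    ext a
    simp [List.mem_ofFn']
  have hzsmem : ∀ z ∈ zs, z ∈ maximalIdeal S := by
    intro z hz
    rcases List.mem_append.mp hz with hz | hz
    · exact hmem z hz
    · obtain ⟨j, rfl⟩ := (List.mem_ofFn' t z).mp hz
      exact htm j
  -- `zs` is a system of parameters
  set s : Fin n → S := fun k => zs[(k : ℕ)]'(k.2.trans_eq hzslen.symm) with hs
  have hrange : Set.range s = {z | z ∈ zs} := by
    ext a
    simp only [Set.mem_range, Set.mem_setOf_eq, hs]
    constructor
    · rintro ⟨k, rfl⟩
      exact List.getElem_mem _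
    · intro ha
      obtain ⟨i, hi, rfl⟩ := List.mem_iff_getElem.mp ha
      exact ⟨⟨i, hi.trans_eq hzslen⟩, rfl⟩
  have hrange' : Ideal.span (Set.range s) = ofList zs := by
    rw [hrange]
  have hsop : IsSystemOfParameters s := by
    rw [isSystemOfParameters_iff_mem_minimalPrimes, hrange']
    refine ⟨hn, Ideal.mem_minimalPrimes_of_height_eq
      (Ideal.span_le.mpr fun z hz => hzsmem z hz) ?_⟩
    rw [hmax, hzsI, he]
    exact ht
  have hreg : IsWeaklyRegular S (List.ofFn s) :=
    isWeaklyRegular_of_isSystemOfParameters (exists_isRegular_length_eq_ringKrullDim S) s hsop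
  have hofFn : List.ofFn s = zs := by
    apply List.ext_getElem
    · rw [List.length_ofFn, hzslen]
    · intro i h1 h2
      rw [List.getElem_ofFn]
  rw [hofFn, hzs] at hreg
  exact ((isWeaklyRegular_append_iff S xs (List.ofFn t)).mp hreg).1

end Regular

/-! ## Lifting a secant sequence of `M` to an `S`-regular sequence -/

section Lift

variable {S : Type u} [CommRing S] [IsRegularLocalRing S]
variable {M : Type v} [AddCommGroup M] [Module S M] [Module.Finite S M] [Nontrivial M]

/-- **Lifting a secant sequence of `M` modulo `Ann M` to a sequence of the right heights**: for a
secant sequence `r₁, …, r_s ∈ 𝔪` of a finite module `M ≠ 0` over a regular local ring there are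
`r'ᵢ ∈ rᵢ + Ann M` (in `𝔪`) with `ht(r'₁, …, r'_k) ≥ k` for every `k ≤ s` — so `r'` is a weakly
regular sequence on `S` (`isWeaklyRegular_of_length_le_height`) with the same colon modules on
`M` as `r`. Step `k`: `ht(Ann M + (r₁,…,r_{k+1})) ≥ n - d + k + 1 > k`
(`le_height_annihilator_sup_ofList`), so the coset step applies. [cite: Cesnavicius2021, §3.2] -/
theorem exists_lift_secantSequence {rs : List S} (hrs : IsSecantSequence M rs)
    (hmem : ∀ r ∈ rs, r ∈ maximalIdeal S) :
    ∃ rs' : List S, rs'.length = rs.length ∧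
      (∀ (i : ℕ) (hi : i < rs'.length) (hi' : i < rs.length),
        rs'[i] - rs[i] ∈ Module.annihilator S M) ∧
      (∀ r ∈ rs', r ∈ maximalIdeal S) ∧
      ∀ k, k ≤ rs'.length → (k : ℕ∞) ≤ (ofList (rs'.take k)).height := by
  obtain ⟨n, hn⟩ := exists_nat_cast_eq_ringKrullDim (R := S)
  obtain ⟨d', hd'⟩ : ∃ d' : ℕ, Module.supportDim S M = d' := by
    obtain ⟨a, ha⟩ := WithBot.ne_bot_iff_exists.mp (Module.supportDim_ne_bot_of_nontrivial S M)
    have ha' : a ≠ ⊤ := by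
      rintro rfl
      exact supportDim_ne_top (R := S) (M := M) ha.symm
    obtain ⟨d', rfl⟩ := ENat.ne_top_iff_exists.mp ha'
    exact ⟨d', ha.symm⟩
  -- induction on the length of the prefix
  have main : ∀ k, k ≤ rs.length → ∃ xs : List S, xs.length = k ∧
      (∀ (i : ℕ) (hi : i < xs.length) (hi' : i < rs.length), xs[i] - rs[i] ∈ Module.annihilator S M) ∧
      (∀ r ∈ xs, r ∈ maximalIdeal S) ∧
      ∀ j, j ≤ k → (j : ℕ∞) ≤ (ofList (xs.take j)).height := by
    intro k
    induction k with
    | zero =>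
      intro _
      exact ⟨[], rfl, fun i hi => absurd hi (Nat.not_lt_zero i), fun r hr => absurd hr List.not_mem_nil,
        fun j hj => by simp [Nat.le_zero.mp hj]⟩
    | succ k ih =>
      intro hk
      obtain ⟨xs, hxlen, hxcongr, hxmem, hxht⟩ := ih (Nat.le_of_succ_le hk)
      have hklt : k < rs.length := hk
      -- heights: `ht(Ann M + (xs) + (rs[k])) ≥ n - d + k + 1 > k`
      have hcongr' : Module.annihilator S M ⊔ ofList xs =
          Module.annihilator S M ⊔ ofList (rs.take k) := by
        refine sup_ofList_eq_of_sub_mem _ (by rw [hxlen, List.length_take, Nat.min_eq_left (Nat.le_of_succ_le hk)]) ?_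
        intro i hi hi'
        rw [List.getElem_take]
        exact hxcongr i hi (by rw [List.length_take] at hi'; omega)
      have hI : (k : ℕ∞) < (Module.annihilator S M ⊔ ofList xs ⊔ Ideal.span {rs[k]}).height := by
        have h1 := le_height_annihilator_sup_ofList M hrs hmem hn hd' (k := k + 1) hk
        rw [List.take_succ_eq_append_getElem hklt, ofList_append, ofList_singleton, ← sup_assoc,
          ← hcongr'] at h1
        refine lt_of_lt_of_le ?_ h1
        exact_mod_cast (show k < n - d' + (k + 1) by omega)
      obtain ⟨a, ha, hht⟩ := exists_add_mem_le_height_sup_span_singleton (Module.annihilator S M)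
        (ofList xs) rs[k] k (by
          have h0 := hxht k le_rfl
          rwa [List.take_of_length_le hxlen.le] at h0) hI
      refine ⟨xs ++ [rs[k] + a], by simp [hxlen], ?_, ?_, ?_⟩
      · intro i hi hi'
        rw [List.length_append, List.length_singleton, hxlen] at hi
        rcases Nat.lt_succ_iff_lt_or_eq.mp hi with hlt | heq
        · rw [List.getElem_append_left (by rw [hxlen]; exact hlt)]
          exact hxcongr i (by rw [hxlen]; exact hlt) hi'
        · subst heq
          rw [List.getElem_append_right (by rw [hxlen])]
          simp only [hxlen, Nat.sub_self, List.getElem_cons_zero, add_sub_cancel_left]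
          exact ha
      · intro r hr
        rcases List.mem_append.mp hr with hr | hr
        · exact hxmem r hr
        · rw [List.mem_singleton.mp hr]
          exact Ideal.add_mem _ (hmem _ (List.getElem_mem hklt)) (annihilator_le_maximalIdeal M ha)
      · intro j hj
        rcases Nat.lt_succ_iff_lt_or_eq.mp (Nat.lt_succ_of_le hj) with hlt | heq
        · rw [List.take_append_of_le_length (by rw [hxlen]; exact Nat.lt_succ_iff.mp hlt)]
          exact hxht j (Nat.lt_succ_iff.mp hlt)
        · subst heq
          have : (xs ++ [rs[k] + a]).take (k + 1) = xs ++ [rs[k] + a] := by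
            rw [List.take_of_length_le (by simp [hxlen])]
          rw [this, ofList_append, ofList_singleton, Nat.cast_succ]
          exact hht
  obtain ⟨xs, hxlen, hxcongr, hxmem, hxht⟩ := main rs.length le_rfl
  exact ⟨xs, hxlen, hxcongr, hxmem, fun k hk => hxht k (hxlen ▸ hk)⟩

/-- **A regular sequence on `S/(r'₁, …, r'_k)` inside `Ann M`**: with `r'` as in
`exists_lift_secantSequence` (congruent to the secant sequence `r` modulo `Ann M`, of the right
heights), for every `k ≤ s` there are `y₁, …, y_{n-d} ∈ Ann M` (`n = dim S`, `d = dim M`) such that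
`r'₁, …, r'_k, y₁, …, y_{n-d}` is weakly regular on `S`: `ht(Ann M + (r'₁,…,r'_k)) ≥ n - d + k`, so
`n - d` further elements of `Ann M + (r'₁,…,r'_k)` — which may be taken in `Ann M` — raise the
height to `n - d + k`. [cite: Cesnavicius2021, §3.2] -/
theorem exists_isWeaklyRegular_take_append {rs rs' : List S} (hrs : IsSecantSequence M rs)
    (hmem : ∀ r ∈ rs, r ∈ maximalIdeal S) (hlen : rs'.length = rs.length)
    (hcongr : ∀ (i : ℕ) (hi : i < rs'.length) (hi' : i < rs.length),
      rs'[i] - rs[i] ∈ Module.annihilator S M)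
    (hmem' : ∀ r ∈ rs', r ∈ maximalIdeal S) {k : ℕ} (hk : k ≤ rs.length)
    (hht : (k : ℕ∞) ≤ (ofList (rs'.take k)).height)
    {n d : ℕ} (hn : ringKrullDim S = n) (hd : Module.supportDim S M = d) :
    ∃ ys : List S, ys.length = n - d ∧ (∀ y ∈ ys, y ∈ Module.annihilator S M) ∧
      IsWeaklyRegular S (rs'.take k ++ ys) := by
  set J : Ideal S := ofList (rs'.take k) with hJ
  set I : Ideal S := Module.annihilator S M ⊔ J with hI
  have hcongr' : I = Module.annihilator S M ⊔ ofList (rs.take k) := by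
    refine sup_ofList_eq_of_sub_mem _ (by rw [List.length_take, List.length_take, hlen]) ?_
    intro i hi hi'
    rw [List.getElem_take, List.getElem_take]
    rw [List.length_take] at hi hi'
    exact hcongr i (by omega) (by omega)
  have hIht : ((k + (n - d) : ℕ) : ℕ∞) ≤ I.height := by
    have h1 := le_height_annihilator_sup_ofList M hrs hmem hn hd hk
    rw [← hcongr'] at h1
    rwa [show n - d + k = k + (n - d) by omega] at h1
  obtain ⟨t, htI, ht⟩ := exists_forall_mem_and_le_height I J k hht (n - d) hIht
  -- decompose `t j = a j + b j` with `a j ∈ Ann M`, `b j ∈ J`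
  have hdec : ∀ j, ∃ a ∈ Module.annihilator S M, ∃ b ∈ J, a + b = t j := fun j =>
    Submodule.mem_sup.mp (htI j)
  choose a ha b hb hab using hdec
  refine ⟨List.ofFn a, List.length_ofFn, fun y hy => ?_, ?_⟩
  · obtain ⟨j, rfl⟩ := (List.mem_ofFn' a y).mp hy
    exact ha j
  · apply isWeaklyRegular_of_length_le_height
    · intro z hz
      rcases List.mem_append.mp hz with hz | hz
      · exact hmem' z (List.mem_of_mem_take hz)
      · obtain ⟨j, rfl⟩ := (List.mem_ofFn' a z).mp hz
        exact annihilator_le_maximalIdeal M (ha j)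
    · have hideal : ofList (rs'.take k ++ List.ofFn a) = J ⊔ Ideal.span (Set.range t) := by
        rw [ofList_append]
        have hofFn : ofList (List.ofFn a) = Ideal.span (Set.range a) := by
          apply congrArg Ideal.span
          ext z
          simp [List.mem_ofFn']
        rw [hofFn]
        refine le_antisymm (sup_le le_sup_left (Ideal.span_le.mpr ?_))
          (sup_le le_sup_left (Ideal.span_le.mpr ?_))
        · rintro _ ⟨j, rfl⟩
          have : a j = t j - b j := by rw [← hab j]; ring
          rw [this]
          exact Ideal.sub_mem _ (Ideal.mem_sup_right (Ideal.subset_span ⟨j, rfl⟩))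
            (Ideal.mem_sup_left (hb j))
        · rintro _ ⟨j, rfl⟩
          rw [← hab j]
          exact Ideal.add_mem _ (Ideal.mem_sup_right (Ideal.subset_span ⟨j, rfl⟩))
            (Ideal.mem_sup_left (hb j))
      rw [hideal, List.length_append, List.length_ofFn, List.length_take, Nat.min_eq_left (hlen ▸ hk)]
      exact ht

end Lift

end Literature.AlgebraicGeometry.Resolution

end
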